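import Summits.Parity.BatemanHorn.Theses.RoughValueTransport
import Summits.Parity.BatemanHorn.Theorems.BalancedSemiprimeLayer.Negative.Structure
import Summits.Parity.BatemanHorn.Theorems.BalancedSemiprimeLayer.Negative.NatDegreePos
import Summits.Parity.BatemanHorn.Theorems.BalancedSemiprimeLayer.Negative.Strengthenings
import Literature.NumberTheory.Sieve.QuadraticRootsPrimeModuliDFI
import Literature.NumberTheory.Sieve.AletheiaZomleferFukshanskyGarcia2020Applications

/-!
# Line `rough-relaxed-divisor-sieve` — checked skeleton for the crux `BalancedSemiprimeLayer`
(item stmt-Parity-9469, route `RoughValueTransport`, sub-problem Parity/BatemanHorn)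

Crux (by name: `Summit.Parity.BatemanHorn.Theses.RoughValueTransport.BalancedSemiprimeLayer`): for
every Bateman–Horn system `f = (f₀,…,f_{k−1})` and every `ε > 0` there is `δ ∈ (0, 1/4]` with,
eventually in `x`, `Φ_f(x,δ) ≤ P_f(x) + ε·x/(log x)^k`, where `Φ_f(x,δ)` counts the `1 ≤ n ≤ x` all of
whose values `fⱼ(n)` are positive and free of primes `< x^{deg fⱼ(1−δ)/2}` ("jointly rough").

## The line (idea card `Ideas/rough-relaxed-divisor-sieve.md`; triage TRIAGE-r1-{1,2,3}: pass ×3)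

Lever: RELAX BOTH BALANCED PRIMES.  A jointly rough `n ≤ x` that is not a simultaneous prime value
has, in some coordinate `i`, `fᵢ(n) = p₁p₂` with `p₁ ≤ p₂`, `p₁` in the balanced-divisor window
`W = [x^{dᵢ(1−δ)/2}, x^{dᵢ(1+δ)/2}]`.  Majorise `1_{layerᵢ}(n) ≤ #{m ∈ W squarefree : m ∣ fᵢ(n)}·
1[F(n) is x^c-rough]` (`F = ∏ⱼ fⱼ`): neither `p₁` nor the cofactor is kept prime.  The pairs
`𝒫 = {(m,n) : m ∈ W, n ≤ x, m ∣ fᵢ(n)}` sifted by `p ∣ F(n)` (`p < x^c`) form ONE sieve problem of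
dimension `k+1` (the divisor weight doubles coordinate `i`'s density; `m` is automatically rough since
`m ∣ fᵢ(n) ∣ F(n)`), of size `X = x·Σ_{m∈W} ρᵢ(m)/m ≍ c_{fᵢ}·dᵢδ·x log x` — `δ` enters ONLY through the
logarithmic length of the window — so the PROVED uniform fundamental lemma
(`SieveSequence.fundamental_lemma_uniform_holds`) gives `Eᵢ(x,δ) ≪_f (δ/c^{k+1})·x/(log x)^k +
(remainder)`, and `δ ≤ ε·c^{k+1}/C_f` closes the coordinate.  The remainder is a sum over `e ≤ x^c`
of SIGNED sums over the window variable `m` of congruence-count errors (`TypeIPairLevel`): for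
`deg fᵢ = 1` every modulus `me ≤ x^{0.7}` (trivial); for `deg fᵢ = 2` the moduli `me ∈
[x^{1−δ}, x^{1+δ+c}]` straddle `x` and, after Poisson summation in `n`, the remainder is a sum of
level-`e` linear forms of root Weyl sums just beyond `x` (`PairLevelForms`) — for `n²+1` (indeed every
definite `aX²+2bX+c`, `k = 1`) literally the vendored `dukeFriedlanderIwaniec1995_proposition1`
[DukeFriedlanderIwaniec1995, Prop. 1 p. 425 (9)]; no prime modulus is ever needed, so the route's
recorded obstruction ("roots mod p₁q for PRIME p₁ ~ x^{1−δ}, past Iwaniec's M ≤ x^{1−3ε}") is an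
artefact of keeping `p₁` prime.  Degree `≥ 3` coordinates are NOT reached (balanced factors exceed
the number of terms; `Literature.Barriers.Parity.FordMaynardLowLevel`): they are the declared
RESIDUAL stub S6 — the crux restricted to its open regime, recommended for promotion to a route item
(the route's own TWO-LAYER PLAN: LayerLinear / LayerQuadratic / LayerHigher).

## Stubs (6) and composition

* S1 `stub_coordLayerThin_of_typeI` — THE LEVER: `WindowMertens (f i) → TypeIPairLevel f i →
  CoordLayerThin f i` for every coordinate of every BH system (degree-blind sieve step). [L]
* S2 `stub_windowMertens` — window Mertens sums of `ρ_{fᵢ}` (squarefree, coprime-to-`u`, power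
  saving) for `deg fᵢ ≤ 2`. [M–L]
* S3 `stub_typeIPairLevel` — the Type-I level: trivial for `deg fᵢ = 1`; Poisson/Vaaler + partial
  summation from `PairLevelForms` for `deg fᵢ = 2`. [L]
* S4 `stub_pairLevelForms` — pair level forms for EVERY quadratic coordinate of every BH system
  (DFI/Tóth linear forms with spectator/progression twists, polynomial dependence). HARDEST. [XL]
* S5 `stub_pairLevelForms_of_DFI` — the flagship supplier, provable now: the vendored DFI Prop. 1
  gives `PairLevelForms ![aX²+2bX+c] 0` whenever `ac − b² > 0` (so `n²+1`). [M–L]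
* S6 `stub_coordLayerThin_highDegree` — RESIDUAL, open: coordinates of degree `≥ 3`. [open]

Composition (sorry-free, kernel-checked): `card_cruxFilter_le_polyPrimeCount_add` (gluing:
`Φ_f ≤ P_f + Σᵢ Eᵢ`), `systemLayerConclusion_of_coordLayerThin` (`ε/k`, least `δ₀`, `eventually_all`),
`coordLayerThin_of_parts` (degree dispatch), `BalancedSemiprimeLayer_of : BalancedSemiprimeLayer`
(the `k = 0` slice by the PROVED `balancedSemiprimeLayer_iff_pos`).  Flagship (uses S1, S2, S3, S5
only — no S4, no S6): `systemLayerConclusion_dfiQuad`, `systemLayerConclusion_X_sq_add_one` — the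
crux's conclusion for `n² + 1` modulo the three provable-looking stubs and the vendored fact.

## Disproof.lean (gen 2, 2026-08-15T23:41Z) — what this skeleton honours

`_false_without_notAssociated`: used in S1 (the sieve dimension of `F` is `k` only for pairwise
non-associated coordinates — `hasBatemanHornConst_holds`); `_false_without_irreducible`: S2/S4 (`ρᵢ`
bounded on squarefree `m`; non-square discriminant for cancellation);
`_false_without_noFixedPrimeDivisor`: S1 (`ω(p) < 1 ⟺ ρ_F(p) < p`).  Refuted strengthenings: every
stub keeps the tolerance `x/(log x)^k`, the order `∀ ε ∃ δ₀`, and JOINT roughness in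
`coordLayerCount` (`not_cruxCoordinatewise`: spectators stay rough — here they are the other `k−1`
sieve dimensions).  No `-- Targets`, no landed `Negative/` lemma refutes an instance of any stub
(checked by importing `Negative.Structure`, `Negative.NatDegreePos`, `Negative.Strengthenings`).
-/

noncomputable section

open Filter Finset Polynomial Real
open scoped Topology BigOperators

namespace Summit.Parity.BatemanHorn.Cruxes.BalancedSemiprimeLayer.RoughRelaxedDivisorSieve

open Literature.NumberTheory.Sieve
open Summit.Parity.BatemanHorn.Theses.RoughValueTransport (BalancedSemiprimeLayer)
open Summit.Parity.BatemanHorn.Theorems.BalancedSemiprimeLayer.Negative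
  (natDegree_pos_of_isBatemanHornSystem balancedSemiprimeLayer_iff_pos)

/-! ## §0 Objects (all over existing declarations: `polyRootCountMod`, `polyPrimeCount`,
`IsBatemanHornSystem`, `DFI1995.quad`, `dukeFriedlanderIwaniec1995_proposition1`) -/

/-- The crux's conclusion for ONE system `f` of `k` polynomials (verbatim body of
`BalancedSemiprimeLayer`; cf. `Disproof.LayerConclusion`). -/
def SystemLayerConclusion (k : ℕ) (f : Fin k → ℤ[X]) : Prop :=
  ∀ ε : ℝ, 0 < ε → ∃ δ : ℝ, 0 < δ ∧ δ ≤ 1 / 4 ∧ ∀ᶠ x : ℕ in atTop,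
    (((Icc 1 x).filter (fun n : ℕ => ∀ i, 0 < (f i).eval (n : ℤ) ∧
      ∀ p ∈ range ⌈(x : ℝ) ^ (((f i).natDegree : ℝ) * (1 - δ) / 2)⌉₊,
        p.Prime → ¬ ((p : ℤ) ∣ (f i).eval (n : ℤ)))).card : ℝ) ≤
      (polyPrimeCount f x : ℝ) + ε * (x : ℝ) / Real.log x ^ k

/-- Read-back: the crux is `∀ systems, SystemLayerConclusion` (definitional). -/
theorem balancedSemiprimeLayer_iff_systemLayerConclusion :
    BalancedSemiprimeLayer ↔
      ∀ (k : ℕ) (f : Fin k → ℤ[X]), IsBatemanHornSystem f → SystemLayerConclusion k f :=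
  Iff.rfl

/-- The crux's joint sifting condition on `n` at height `x`, depth parameter `δ`: EVERY value
`fⱼ(n)` is positive and has no prime factor `p < x^{deg fⱼ·(1−δ)/2}` (verbatim sub-term of the crux). -/
abbrev JointRough {k : ℕ} (f : Fin k → ℤ[X]) (δ : ℝ) (x n : ℕ) : Prop :=
  ∀ j, 0 < (f j).eval (n : ℤ) ∧
    ∀ p ∈ range ⌈(x : ℝ) ^ (((f j).natDegree : ℝ) * (1 - δ) / 2)⌉₊,
      p.Prime → ¬ ((p : ℤ) ∣ (f j).eval (n : ℤ))

/-- **Coordinate layer count** `Eᵢ(x, δ)`: the `1 ≤ n ≤ x` that are JOINTLY rough (all coordinates,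
exactly as in the crux — the spectators stay rough, cf. the refuted `not_cruxCoordinatewise`) and
whose `i`-th value is NOT prime.  For `δ ≤ 1/4`, eventually these are the `n` with `fᵢ(n) = 1`, a
prime square, or a balanced semiprime `p₁p₂`, `x^{dᵢ(1−δ)/2} ≤ p₁ ≤ p₂`. -/
def coordLayerCount {k : ℕ} (f : Fin k → ℤ[X]) (i : Fin k) (δ : ℝ) (x : ℕ) : ℕ :=
  #((Icc 1 x).filter (fun n : ℕ => JointRough f δ x n ∧ ¬ ((f i).eval (n : ℤ)).toNat.Prime))

/-- **`CoordLayerThin f i`** — the coordinate-`i` layer of `f` is thin: for every `ε > 0` there is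
`δ₀ > 0` such that for EVERY `δ ∈ (0, δ₀]`, eventually `Eᵢ(x, δ) ≤ ε·x/(log x)^k` (the monotone
"all small `δ`" form, cf. `balancedSemiprimeLayer_iff_eventually_small`; tolerance `(log x)^{−k}`,
order `∀ ε ∃ δ₀` — not one of the refuted strengthenings). -/
def CoordLayerThin {k : ℕ} (f : Fin k → ℤ[X]) (i : Fin k) : Prop :=
  ∀ ε : ℝ, 0 < ε → ∃ δ₀ : ℝ, 0 < δ₀ ∧ ∀ δ : ℝ, 0 < δ → δ ≤ δ₀ → ∀ᶠ x : ℕ in atTop,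
    (coordLayerCount f i δ x : ℝ) ≤ ε * (x : ℝ) / Real.log x ^ k

/-- The **balanced-divisor window** of a coordinate of degree `d` at height `x`:
`W(x, δ) = ℕ ∩ [x^{d(1−δ)/2}, x^{d(1+δ)/2}]`, of logarithmic length `dδ·log x`.  The smaller prime
factor of a balanced semiprime value `fᵢ(n)`, `n ≤ x`, lies in `W` eventually (`√fᵢ(n) ≤ C x^{d/2}`). -/
def window (d : ℕ) (δ : ℝ) (x : ℕ) : Finset ℕ :=
  Icc ⌈(x : ℝ) ^ ((d : ℝ) * (1 - δ) / 2)⌉₊ ⌊(x : ℝ) ^ ((d : ℝ) * (1 + δ) / 2)⌋₊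

/-- `ρ_g(m) = #{ν mod m : g(ν) ≡ 0 (mod m)}` for EVERY modulus `m` (`polyRootCountMod ![g] m`). -/
abbrev rho (g : ℤ[X]) (m : ℕ) : ℕ := polyRootCountMod ![g] m

/-- **`WindowMertens g`** — window Mertens sums of `ρ_g(m)/m` over SQUAREFREE `m` coprime to a
squarefree `u`, with the exact main term, a power saving in the lower end `A` and polynomial loss in
`u`: there are `c > 0`, `C`, `θ > 0` with, for all squarefree `u` and `1 ≤ A ≤ B`,
`|Σ_{A ≤ m ≤ B, m sqfree, (m,u)=1} ρ_g(m)/m − c·∏_{p ∣ u}(1 + ρ_g(p)/p)⁻¹·log(B/A)| ≤ C·u^C·A^{−θ}`.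
(`c` = residue at `s = 0` of `∏_p (1 + ρ_g(p)p^{−1−s})`, e.g. `∝ L(1, χ_Δ)` for a quadratic; the
`u`-factor is exact; the secondary constants of the two initial segments cancel in the window.  Only
`ρ_g(p)` at PRIMES enters.)  This is the density input of the `(k+1)`-st sieve dimension (the window
variable `m`) in S1, consumed with `u ∣ P(x^c)`, `u ≤ x^c`. -/
def WindowMertens (g : ℤ[X]) : Prop :=
  ∃ c C θ : ℝ, 0 < c ∧ 0 < θ ∧ ∀ (u A B : ℕ), Squarefree u → 1 ≤ A → A ≤ B →
    |(∑ m ∈ (Icc A B).filter (fun m : ℕ => Squarefree m ∧ Nat.Coprime m u), (rho g m : ℝ) / m) -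
        c * (∏ p ∈ u.primeFactors, (1 + (rho g p : ℝ) / p)⁻¹) * Real.log ((B : ℝ) / A)| ≤
      C * (u : ℝ) ^ C * (A : ℝ) ^ (-θ)

/-- **Pair count** `P(x; m, e) = #{1 ≤ n ≤ x : m ∣ fᵢ(n), e ∣ F(n)}`, `F = ∏ⱼ fⱼ`: the congruence
sums `|𝒫_e|` of the divisor-weighted line `𝒫 = {(m, n) : m ∈ W, n ≤ x, m ∣ fᵢ(n)}` sifted by the
primes dividing `F(n)` (summed over `m` they are `Σ_{m ∈ W} P(x; m, e)`). -/
def pairCount {k : ℕ} (f : Fin k → ℤ[X]) (i : Fin k) (x m e : ℕ) : ℕ :=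
  #((Icc 1 x).filter (fun n : ℕ =>
      ((m : ℤ) ∣ (f i).eval (n : ℤ)) ∧ ((e : ℤ) ∣ ∏ j, (f j).eval (n : ℤ))))

/-- The EXACT density `θ(m, e) = #{n mod me : m ∣ fᵢ(n), e ∣ F(n)}/(me)` of that periodic set
(period divides `me`; for `(m, e) = 1` it is `ρᵢ(m)/m · ρ_F(e)/e`). -/
def pairDensity {k : ℕ} (f : Fin k → ℤ[X]) (i : Fin k) (m e : ℕ) : ℝ :=
  (#((range (m * e)).filter (fun n : ℕ =>
      ((m : ℤ) ∣ (f i).eval (n : ℤ)) ∧ ((e : ℤ) ∣ ∏ j, (f j).eval (n : ℤ)))) : ℝ) / ((m : ℝ) * e)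

/-- The signed remainder `r(x; m, e) = P(x; m, e) − x·θ(m, e)`. -/
def pairRem {k : ℕ} (f : Fin k → ℤ[X]) (i : Fin k) (x m e : ℕ) : ℝ :=
  (pairCount f i x m e : ℝ) - (x : ℝ) * pairDensity f i m e

/-- **`TypeIPairLevel f i`** — Type-I information for the divisor-weighted line of coordinate `i`
WITH CANCELLATION OVER THE WINDOW VARIABLE (the remainders are summed over `m ∈ W(x, δ)`, `t ∣ m`,
INSIDE the absolute value; `t` serves the squarefree sieve-out of `m`, `t = s²`): for some `c > 0`,
every `δ ∈ (0, c]`, some `η = η(δ) > 0`, eventually in `x`,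
`Σ_{e ≤ x^c} Σ_{t ≤ x^c} |Σ_{m ∈ W(x,δ), t ∣ m} r(x; m, e)| ≤ x^{1−η}`.
Degree 1: every modulus `me ≤ x^{1/2+δ/2+2c}` — trivial.  Degree 2: `me ∈ [x^{1−δ}, x^{1+δ+c}]`
straddles `x`; this is where root equidistribution BEYOND `x` enters (`PairLevelForms`, S3/S4).
(`c` may always be decreased: sub-sums and a smaller `δ`-range.) -/
def TypeIPairLevel {k : ℕ} (f : Fin k → ℤ[X]) (i : Fin k) : Prop :=
  ∃ c : ℝ, 0 < c ∧ ∀ δ : ℝ, 0 < δ → δ ≤ c → ∃ η : ℝ, 0 < η ∧ ∀ᶠ x : ℕ in atTop,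
    (∑ e ∈ Icc 1 ⌊(x : ℝ) ^ c⌋₊, ∑ t ∈ Icc 1 ⌊(x : ℝ) ^ c⌋₊,
        |∑ m ∈ (window (f i).natDegree δ x).filter (fun m : ℕ => t ∣ m), pairRem f i x m e|) ≤
      (x : ℝ) ^ (1 - η)

/-- **Pair Weyl sum** `W(h; m, e) = Σ_{n mod me : m ∣ fᵢ(n), e ∣ F(n)} e(hn/(me))` — the finite
Fourier transform of the root set of the pair condition.  For `k = 1` (`F = f₀ = g`):
`W(h; m, e) = G·1[G ∣ h]·ρ_{h/G}(lcm(m,e))` with `G = gcd(m,e)` and DFI's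
`ρ_h(n) = polyRootWeylSum g n h`; in general (`n = α + e·j`, any `m, e`)
`W(h; m, e) = Σ_{α < e, e ∣ F(α)} e(hα/(me))·polyRootWeylSum (fᵢ(α + eX)) m h` — root Weyl sums of
the `≤ e` SHIFTED polynomials; for `(m,e) = 1` also `S_{fᵢ}(h·ē; m)·S_F(h·m̄; e)` (CRT). -/
def pairWeylSum {k : ℕ} (f : Fin k → ℤ[X]) (i : Fin k) (m e : ℕ) (h : ℤ) : ℂ :=
  ∑ n ∈ (range (m * e)).filter (fun n : ℕ =>
      ((m : ℤ) ∣ (f i).eval (n : ℤ)) ∧ ((e : ℤ) ∣ ∏ j, (f j).eval (n : ℤ))),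
    Complex.exp (2 * Real.pi * Complex.I * ((h : ℂ) * (n : ℂ) / ((m : ℂ) * (e : ℂ))))

/-- **`PairLevelForms f i`** — level-`e` linear forms of the pair Weyl sums, with a power saving
in the length and polynomial losses in `e`, `t`, `|h|` (the shape of DFI 1995 Prop. 1 / Tóth 2000,
spectators and the progression `t ∣ m` built in): there are `A`, `η > 0`, `K` with
`‖Σ_{m ≤ N, t ∣ m} W(h; m, e)‖ ≤ K·(e·t·|h|)^A·N^{1−η}` for all `e, t ≥ 1`, `h ≠ 0`, `N ≥ 1`
(ranges `N ≤ (et|h|)^{A/η}` are covered by the trivial bound `|W| ≤ e·ρᵢ(m)`). -/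
def PairLevelForms {k : ℕ} (f : Fin k → ℤ[X]) (i : Fin k) : Prop :=
  ∃ A η K : ℝ, 0 < η ∧ ∀ (e t : ℕ) (h : ℤ) (N : ℕ), 1 ≤ e → 1 ≤ t → h ≠ 0 → 1 ≤ N →
    ‖∑ m ∈ (Icc 1 N).filter (fun m : ℕ => t ∣ m), pairWeylSum f i m e h‖ ≤
      K * ((e : ℝ) * t * |(h : ℝ)|) ^ A * (N : ℝ) ^ (1 - η)

/-! ## §1 The stubs (`sorry` lives ONLY here) -/

/-- **S1 — THE LEVER: relax both primes and sieve the divisor-weighted line** (degree-blind).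
For a Bateman–Horn system `f` and any coordinate `i`: window Mertens sums for `fᵢ` and Type-I level
for the pair counts imply that the coordinate-`i` layer is thin.
Proof plan (size L): (1) majorant — for `δ ≤ 1/4` and `x` large, a jointly rough `n ≤ x` with
`fᵢ(n)` not prime has `fᵢ(n) ∈ {1, p², p₁p₂}` with `p, p₁ ∈ W(x,δ)` squarefree, and `F(n)` is
`x^c`-rough for `c ≤ 3/8`; so `Eᵢ(x,δ) ≤ O(1) + S(𝒫, x^c)` for the pair family
`𝒫 = {(m,n) : m ∈ W squarefree, 1 ≤ n ≤ x, m ∣ fᵢ(n)}` sifted by `p ∣ F(n)`, `p < x^c`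
(re-index by `N = F(n)` to use `SieveSequence`). (2) `|𝒫_d| = Σ_{m ∈ W sqfree} P(x; m, d)`;
with `θ(sm', sd') = ρᵢ(s)/s · ρᵢ(m')/m' · ρ_F(d')/d'` (`s = (m,d)`) and `WindowMertens (f i)`
(`u = d`), `|𝒫_d| = ω(d)·X + O(x·d^C·A^{−θ}) + Σ_m r(x; m, d)`, `X = c·x·log(B/A) ≍ δ·x log x`,
`ω(p) = (ρ_F(p) + ρᵢ(p))/(p + ρᵢ(p))` multiplicative, `ω(p) < 1 ⟺ ρ_F(p) < p`
(`hasNoFixedPrimeDivisor` — `_false_without_noFixedPrimeDivisor`), dimension `k + 1` with `K`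
uniform (`hasBatemanHornConst_holds` for `f` and for `![f i]` + Mertens
`tendsto_log_mul_prod_one_sub_inv_nat`; `pairwise_not_associated` is what makes the dimension of
`F` equal to `k` — `_false_without_notAssociated`), `V(x^c) ≪_f (c log x)^{−(k+1)}`.
(3) `SieveSequence.fundamental_lemma_uniform_holds` (PROVED; level `D = z = x^c`, upper half):
`S ≤ C(κ,K)·X·V + Σ_{d ≤ x^c} |R_d|`; the squarefree condition on `m` inside `R_d` is removed by
`μ²(m) = Σ_{s² ∣ m} μ(s)` with `s ≤ x^{c/2}` fed to `TypeIPairLevel` (`t = s²`) and `s > x^{c/2}`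
bounded trivially through `#{n ≤ x : s² ∣ fᵢ(n)}`. (4) Total `Eᵢ ≤ C_f·(δ/c^{k+1})·x/(log x)^k +
C'_f·x/(c^{k+1}(log x)^{k+1}) + x^{1−η}`; given `ε` take `δ₀ = min(c, ε c^{k+1}/(2C_f))`.
Leans on: `fundamental_lemma_uniform_holds`, `IsBatemanHornSystem.hasBatemanHornConst_holds`,
`Literature.NumberTheory.LFunctions.Mertens.tendsto_log_mul_prod_one_sub_inv_nat`, `polyRootCountMod_le`,
`natDegree_pos_of_isBatemanHornSystem`.  Why plausibly true: it is Hooley's 1967 divisor-switched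
sieve (Acta Math. 117, p. 285 (15)) with the second roughness made automatic; numerics
(Ideator2Numerics, TRIAGE-r1-3 §(iii)): majorant/layer ratio `K(c)` independent of `δ`, `K(c)c^{k+1}`
constant. -/
theorem stub_coordLayerThin_of_typeI :
    ∀ {k : ℕ} (f : Fin k → ℤ[X]), IsBatemanHornSystem f → ∀ i : Fin k,
      WindowMertens (f i) → TypeIPairLevel f i → CoordLayerThin f i := by
  sorry

/-- **S2 — window Mertens sums for coordinates of degree ≤ 2** (size M–L, provable now).
For an (irreducible, primitive) `g = fᵢ` of degree 1: `ρ_g(m) = 1[(m, a) = 1]` on squarefree `m`,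
and `Σ_{m ≤ y, m sqfree, (m,ua)=1} 1/m = c·∏_{p∣u, p∤a}(1+1/p)⁻¹·log y + c'(u) + O(τ(u)·y^{−1/2})`.
Degree 2, discriminant `Δ` (non-square: `_false_without_irreducible`): on squarefree `m` prime to
`2aΔ`, `ρ_g(m) = ∏_{p∣m}(1 + (Δ/p)) = Σ_{d∣m} χ_Δ(d)`, and the hyperbola method with
`|Σ_{n≤t} χ_Δ(n)| ≤ |Δ|` gives `Σ_{m ≤ y, sqfree, (m,u)=1} ρ_g(m)/m = c·κ(u)·log y + c'(u) +
O(u^ε·y^{−θ})`, `κ(u) = ∏_{p∣u}(1+ρ_g(p)/p)⁻¹` EXACTLY (residue of `∏_{p∤u}(1+ρ_g(p)p^{−1−s})` at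
`s = 0`); subtracting two initial segments kills `c'(u)`.  `c > 0`: `L(1,χ_Δ) ≠ 0` / the PROVED
`hasBatemanHornConst_holds` for `![g]`.  Leans on: Mathlib `ZMod.χ₄`/`jacobiSym`/quadratic
reciprocity, `Nat.Coprime`, `Squarefree`, `ArithmeticFunction.moebius`; tree
`polyRootCountMod_X_sq_add_one` (the `n²+1` case: `ρ(p) = 1 + χ₄(p)`), `hasBatemanHornConst_holds`.
(Sharpening asked for by TRIAGE-r1-3 (a).) -/
theorem stub_windowMertens :
    ∀ {k : ℕ} (f : Fin k → ℤ[X]), IsBatemanHornSystem f → ∀ i : Fin k,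
      (f i).natDegree ≤ 2 → WindowMertens (f i) := by
  sorry

/-- **S3 — the Type-I level for coordinates of degree ≤ 2** (size L).
Degree 1 (no hypothesis used): `m ≤ x^{(1+δ)/2}`, so each residue class mod `me` meets `[1, x]` in
`x/(me) + O(1)` integers and `|r(x; m, e)| ≤ e·ρᵢ(m) ≤ e`; summing, `Σ_{e,t ≤ x^c} Σ_{m ∈ W, t∣m} e ≤
x^{1/2 + δ/2 + 3c + o(1)} ≤ x^{1−η}` for `c = 1/20`, `δ ≤ c`.
Degree 2 (from `PairLevelForms f i`, constants `A, η₀, K`): write `#{1 ≤ n ≤ x : n ≡ r (q)} − x/q =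
ψ(−r/q) − ψ((x−r)/q)` (`q = me`, `ψ(y) = {y} − 1/2`) and expand `ψ` by Vaaler's trigonometric
polynomials of degree `H = x^{3δ+2c}`: the frequencies `0 < |h| ≤ H` produce exactly
`Σ_{m ∈ W, t∣m} W(h; m, e)` (differences of two `PairLevelForms` sums, `≤ 2K(etH)^A B^{1−η₀}`,
`B = x^{1+δ}`), the phase `e(hx/(me))` of the second `ψ` is removed by partial summation in `m`
(factor `≤ 1 + 2π H x^{δ}`), and `h = 0` costs `Σ_m e·ρᵢ(m)/H ≤ e·B^{1+o(1)}/(tH)`.  Exponent budget: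
total `≤ x^{2c + A(4c+3δ) + 5δ + 2c + (1+δ)(1−η₀) + o(1)} + x^{1−2δ+2c+o(1)}`, which is `≤ x^{1−η}`
once `c` (ours to choose: `∃ c`) and `δ ≤ c` are small against `η₀/(10 + 7A)`; `η = min(η₀/4, δ)`.
Leans on: `PairLevelForms`, Mathlib `Int.fract`, `Finset.sum` manipulations, `Complex.exp` bounds;
the tree's `RootForms.sum_weylSum_eq_sum_levelForms` (DFI §2 with level `d`, PROVED) is the model
for the Poisson/level-form bookkeeping. -/
theorem stub_typeIPairLevel :
    ∀ {k : ℕ} (f : Fin k → ℤ[X]), IsBatemanHornSystem f → ∀ i : Fin k,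
      (f i).natDegree ≤ 2 → ((f i).natDegree = 2 → PairLevelForms f i) → TypeIPairLevel f i := by
  sorry

/-- **S4 — pair level forms for EVERY quadratic coordinate of every Bateman–Horn system**
(HARDEST; size XL; true on all standard expectations, in print only in special shapes).
Reduction (elementary, any `m, e`): writing `n = α + e·j` (`0 ≤ α < e`, `j mod m`) gives
`W(h; m, e) = Σ_{α < e, e ∣ F(α)} e(hα/(me)) · S_{g_α}(h; m)`, `g_α(X) := fᵢ(α + eX)` (a quadratic of
discriminant `e²Δ`), `S_g(h; m) = Σ_{g(j)≡0 (m)} e(hj/m) = polyRootWeylSum g m h`; the phase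
`e(hα/(me))` is removed by partial summation in `m` (variation `≤ |h|/M`).  So the claim is: level-`t`
linear forms `Σ_{M<m'≤2M} S_{g_α}(h; t·m')` (`= DFI1995.linearForm g_α h t M`) have a power saving
with a constant POLYNOMIAL in `e, t, |h|` — uniformly over the `≤ e` shifts `g_α` — i.e. the card's
`ShiftUniformLevelLinearForms (f i)`.  Sources: definite even-middle-coefficient quadratics, constant
depending on the quadratic: [DukeFriedlanderIwaniec1995, Prop. 1 p. 425 (9); Prop. 4 p. 432]
(vendored; S5 is its `k = 1`, shift-free use); indefinite: [Toth2000] (cycle integrals; the tree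
holds the shape as hypothesis `HL` of
`toth2000_quadraticRoots_primeModuli_of_linearFormBound_of_bilinearFormBound`); explicit `h`:
[Homma2008, Thm 1]; restated [Ngo2024, (1.2)]; odd middle coefficient via `4a·g = (2aX+b)² − Δ`;
prototype for all moduli PROVED in the tree: `hooley1963_quadraticRoots_allModuli_logSqSaving_holds`
(`x^{3/4} log² x`, fixed `h`, level 1; its proof runs through the level-`d` correspondence
`RootForms.sum_weylSum_eq_sum_levelForms`).  What is NOT in print and is the genuine content:
polynomial dependence of the spectral constants on the coefficients / the level (`Γ₀(q)`,
`q ∣ 4a·e²Δ·t`: Kuznetsov + Weil, Selberg/Kim–Sarnak gap uniform in `q`) — "standard, unprinted"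
(card; TRIAGE-r1-2).  Equivalent packaging: the twisted sums `Σ_{m ≡ β (e)} S_{fᵢ}(h ē_m; m)` of card
smooth-modulus-twisted-hooley (`TwistedHooleyDilates`), numerically square-root cancelling uniformly
in `Q ≤ 35`, all classes, `h ≤ 1009`, `M = 10⁶`, definite and indefinite (TRIAGE-r1-2 §C, r1-3).
Why it might fail: only through a mis-set range — all degenerate ranges are absorbed by `(et|h|)^A`
(`N ≤ (et|h|)^{A/η}`: trivial bound `|W| ≤ e·ρᵢ(m)`); uses `irreducible` (non-square `Δ`:
`_false_without_irreducible`). -/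
theorem stub_pairLevelForms :
    ∀ {k : ℕ} (f : Fin k → ℤ[X]), IsBatemanHornSystem f → ∀ i : Fin k,
      (f i).natDegree = 2 → PairLevelForms f i := by
  sorry

/-- **S5 — the flagship supplier (provable now from the vendored fact; size M–L).**  DFI 1995
Proposition 1 (`dukeFriedlanderIwaniec1995_proposition1`: for `f = aX²+2bX+c`, `ac − b² > 0`:
`‖L_d(M)‖ = ‖Σ_{M<m≤2M} ρ_h(dm)‖ ≤ K(h,d)^{1/20}(d/M)^{1/20}M^{1+ε}` for `d ≤ C₁M`, `h ≤ C₂dM`,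
`K = K(a,b,c,ε,C₁,C₂)` uniform in `h, d, M`) gives `PairLevelForms ![aX²+2bX+c] 0`.
Proof plan: `k = 1`, so `W(h; m, e) = G·1[G ∣ h]·ρ_{h/G}(lcm(m, e))`, `G = gcd(m, e)` (the `G`
shifts `n ↦ n + lcm` contribute `Σ_{j<G} e(hj/G)`); hence `Σ_{m ≤ N, t∣m} W = Σ_{G ∣ (e,h)} G·
Σ_{s ∣ e/G} μ(s) Σ_{m₂ ≤ N/(G·l)} ρ_{h/G}(e·l·m₂)`, `l = lcm(t/(t,G), s)` — at most `τ(e)²` level-`el`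
DFI linear forms, each split dyadically; apply the fact with `ε = 1/40`, `C₁ = C₂ = 1` where
`M ≥ max(el, |h|)` and the trivial bound `‖L‖ ≤ Σ ρ(dm) ≤ (dM)^{o(1)}M` elsewhere; `ρ_{−h} = conj ρ_h`
for `h < 0`.  Result: `A = 3`, `η = 1/40`.  Leans on: `dukeFriedlanderIwaniec1995_proposition1`,
`DFI1995.linearForm`, `polyRootWeylSum`, `norm_polyRootWeylSum_le`, `Nat.lcm`/`Nat.gcd`, Möbius
inversion (`ArithmeticFunction.moebius`).  With S1–S3 this closes the crux's conclusion for `n² + 1`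
and every BH quadratic `aX²+2bX+c` with `ac > b²` (`systemLayerConclusion_dfiQuad`,
`systemLayerConclusion_X_sq_add_one` below). -/
theorem stub_pairLevelForms_of_DFI :
    dukeFriedlanderIwaniec1995_proposition1 →
      ∀ a b c : ℤ, 0 < a * c - b ^ 2 → PairLevelForms ![DFI1995.quad a b c] 0 := by
  sorry

/-- **S6 — RESIDUAL, NOT REACHED BY THIS LINE: coordinates of degree ≥ 3** (open; the crux
restricted to its open regime — declared up front as TRIAGE-r1-2 §A requires).  For `d ≥ 3` the
balanced factors `p₁ ~ x^{d(1−δ)/2} > x` exceed the number of terms: no Type-I/II information is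
available (`Literature.Barriers.Parity.FordMaynardLowLevel`; the card's Barriers (i)–(ii): a
divisor-family sieve would need per-frequency savings `> 1 − 2/d` for degree-`d` root Weyl sums at
`M ~ x^{d/2}`, beyond square-root for `d ≥ 5`).  Recommended: the tenure planner promotes it to the
route item `LayerHigher` of the foreseen degree split (lead outcome `promote-stub`); S1 stays valid
for these coordinates, only `TypeIPairLevel` has no supplier. -/
theorem stub_coordLayerThin_highDegree :
    ∀ {k : ℕ} (f : Fin k → ℤ[X]), IsBatemanHornSystem f → ∀ i : Fin k,
      3 ≤ (f i).natDegree → CoordLayerThin f i := by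
  sorry

/-! ## §2 Composition (sorry-free) -/

/-- **Gluing**: the crux's count is at most the prime count plus the sum of the coordinate layers
(`Φ_f(x,δ) ≤ P_f(x) + Σᵢ Eᵢ(x,δ)`): a jointly rough `n` is either a simultaneous (positive) prime
value — counted by `polyPrimeCount` — or has a non-prime value in some coordinate. -/
theorem card_cruxFilter_le_polyPrimeCount_add {k : ℕ} (f : Fin k → ℤ[X]) (δ : ℝ) (x : ℕ) :
    #((Icc 1 x).filter (fun n : ℕ => ∀ i, 0 < (f i).eval (n : ℤ) ∧
      ∀ p ∈ range ⌈(x : ℝ) ^ (((f i).natDegree : ℝ) * (1 - δ) / 2)⌉₊,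
        p.Prime → ¬ ((p : ℤ) ∣ (f i).eval (n : ℤ)))) ≤
      polyPrimeCount f x + ∑ i, coordLayerCount f i δ x := by
  set S : Finset ℕ := (Icc 1 x).filter (fun n : ℕ => JointRough f δ x n) with hS
  set A : Finset ℕ := S.filter (fun n : ℕ => ∀ i, ((f i).eval (n : ℤ)).toNat.Prime) with hA
  set U : Finset ℕ := (Finset.univ : Finset (Fin k)).biUnion
    (fun i => S.filter (fun n : ℕ => ¬ ((f i).eval (n : ℤ)).toNat.Prime)) with hU
  have hsplit : S ⊆ A ∪ U := by
    intro n hn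
    by_cases h : ∀ i, ((f i).eval (n : ℤ)).toNat.Prime
    · exact mem_union_left _ (mem_filter.mpr ⟨hn, h⟩)
    · push Not at h
      obtain ⟨i, hi⟩ := h
      exact mem_union_right _ (mem_biUnion.mpr ⟨i, mem_univ _, mem_filter.mpr ⟨hn, hi⟩⟩)
  have hAle : #A ≤ polyPrimeCount f x := by
    unfold polyPrimeCount
    refine card_le_card fun n hn => ?_
    rw [hA, hS, Finset.mem_filter, Finset.mem_filter, Finset.mem_Icc] at hn
    obtain ⟨⟨hn1, hrough⟩, hprime⟩ := hn
    simp only [Finset.mem_filter, Finset.mem_range]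
    exact ⟨by omega, fun i => ⟨(hrough i).1, hprime i⟩⟩
  have hUle : #U ≤ ∑ i, coordLayerCount f i δ x := by
    refine card_biUnion_le.trans (Finset.sum_le_sum fun i _ => le_of_eq ?_)
    unfold coordLayerCount
    rw [hS, Finset.filter_filter]
  calc #((Icc 1 x).filter (fun n : ℕ => ∀ i, 0 < (f i).eval (n : ℤ) ∧
        ∀ p ∈ range ⌈(x : ℝ) ^ (((f i).natDegree : ℝ) * (1 - δ) / 2)⌉₊,
          p.Prime → ¬ ((p : ℤ) ∣ (f i).eval (n : ℤ)))) = #S := by rfl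
    _ ≤ #(A ∪ U) := card_le_card hsplit
    _ ≤ #A + #U := card_union_le _ _
    _ ≤ polyPrimeCount f x + ∑ i, coordLayerCount f i δ x := add_le_add hAle hUle

/-- **Per-system synthesis** (`k ≥ 1`): thin layers in every coordinate give the crux's conclusion
for the system — split `ε` evenly over the `k` coordinates, take the least `δ₀` (capped at `1/4`),
intersect the `k` eventualities (`eventually_all`), glue. -/
theorem systemLayerConclusion_of_coordLayerThin {k : ℕ} (hk : 0 < k) (f : Fin k → ℤ[X])
    (h : ∀ i, CoordLayerThin f i) : SystemLayerConclusion k f := by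
  intro ε hε
  have hkR : (0 : ℝ) < k := by exact_mod_cast hk
  set ε' : ℝ := ε / k with hε'
  have hε'pos : 0 < ε' := div_pos hε hkR
  choose δ₀ hδ₀pos hδ₀ using fun i => h i ε' hε'pos
  have hne : (Finset.univ : Finset (Fin k)).Nonempty := ⟨⟨0, hk⟩, mem_univ _⟩
  set δ : ℝ := min (1 / 4) (Finset.univ.inf' hne δ₀) with hδdef
  have hδpos : 0 < δ := lt_min (by norm_num) ((Finset.lt_inf'_iff hne).2 fun i _ => hδ₀pos i)
  have hδle : ∀ i, δ ≤ δ₀ i := fun i =>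
    (min_le_right _ _).trans (Finset.inf'_le _ (mem_univ i))
  refine ⟨δ, hδpos, min_le_left _ _, ?_⟩
  have hev : ∀ᶠ x : ℕ in atTop, ∀ i, (coordLayerCount f i δ x : ℝ) ≤ ε' * (x : ℝ) / Real.log x ^ k :=
    eventually_all.mpr fun i => hδ₀ i δ hδpos (hδle i)
  filter_upwards [hev] with x hx
  have hglue := card_cruxFilter_le_polyPrimeCount_add f δ x
  have hglueR : (((Icc 1 x).filter (fun n : ℕ => ∀ i, 0 < (f i).eval (n : ℤ) ∧
        ∀ p ∈ range ⌈(x : ℝ) ^ (((f i).natDegree : ℝ) * (1 - δ) / 2)⌉₊,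
          p.Prime → ¬ ((p : ℤ) ∣ (f i).eval (n : ℤ)))).card : ℝ) ≤
      (polyPrimeCount f x : ℝ) + ∑ i, (coordLayerCount f i δ x : ℝ) := by
    exact_mod_cast hglue
  have hsum : ∑ i, (coordLayerCount f i δ x : ℝ) ≤ ∑ _i : Fin k, ε' * (x : ℝ) / Real.log x ^ k :=
    Finset.sum_le_sum fun i _ => hx i
  have hconst : ∑ _i : Fin k, ε' * (x : ℝ) / Real.log x ^ k = ε * (x : ℝ) / Real.log x ^ k := by
    rw [Finset.sum_const, Finset.card_univ, Fintype.card_fin, nsmul_eq_mul, hε']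
    field_simp
  linarith

/-- **Degree dispatch**: every coordinate of a Bateman–Horn system has a thin layer, from the parts
(S1 fed by S2 + S3(+S4) for degree ≤ 2; S6 for degree ≥ 3). -/
theorem coordLayerThin_of_parts
    (h₁ : ∀ {k : ℕ} (f : Fin k → ℤ[X]), IsBatemanHornSystem f → ∀ i : Fin k,
      WindowMertens (f i) → TypeIPairLevel f i → CoordLayerThin f i)
    (h₂ : ∀ {k : ℕ} (f : Fin k → ℤ[X]), IsBatemanHornSystem f → ∀ i : Fin k,
      (f i).natDegree ≤ 2 → WindowMertens (f i))
    (h₃ : ∀ {k : ℕ} (f : Fin k → ℤ[X]), IsBatemanHornSystem f → ∀ i : Fin k,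
      (f i).natDegree ≤ 2 → ((f i).natDegree = 2 → PairLevelForms f i) → TypeIPairLevel f i)
    (h₄ : ∀ {k : ℕ} (f : Fin k → ℤ[X]), IsBatemanHornSystem f → ∀ i : Fin k,
      (f i).natDegree = 2 → PairLevelForms f i)
    (h₆ : ∀ {k : ℕ} (f : Fin k → ℤ[X]), IsBatemanHornSystem f → ∀ i : Fin k,
      3 ≤ (f i).natDegree → CoordLayerThin f i)
    {k : ℕ} (f : Fin k → ℤ[X]) (hf : IsBatemanHornSystem f) (i : Fin k) : CoordLayerThin f i := by
  rcases Nat.lt_or_ge 2 (f i).natDegree with hd | hd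
  · exact h₆ f hf i (by omega)
  · exact h₁ f hf i (h₂ f hf i hd) (h₃ f hf i hd (fun h2 => h₄ f hf i h2))

/-- The crux's statement, system by system for `k ≥ 1`, from the parts. -/
theorem systemLayerConclusion_of_parts
    (h₁ : ∀ {k : ℕ} (f : Fin k → ℤ[X]), IsBatemanHornSystem f → ∀ i : Fin k,
      WindowMertens (f i) → TypeIPairLevel f i → CoordLayerThin f i)
    (h₂ : ∀ {k : ℕ} (f : Fin k → ℤ[X]), IsBatemanHornSystem f → ∀ i : Fin k,
      (f i).natDegree ≤ 2 → WindowMertens (f i))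
    (h₃ : ∀ {k : ℕ} (f : Fin k → ℤ[X]), IsBatemanHornSystem f → ∀ i : Fin k,
      (f i).natDegree ≤ 2 → ((f i).natDegree = 2 → PairLevelForms f i) → TypeIPairLevel f i)
    (h₄ : ∀ {k : ℕ} (f : Fin k → ℤ[X]), IsBatemanHornSystem f → ∀ i : Fin k,
      (f i).natDegree = 2 → PairLevelForms f i)
    (h₆ : ∀ {k : ℕ} (f : Fin k → ℤ[X]), IsBatemanHornSystem f → ∀ i : Fin k,
      3 ≤ (f i).natDegree → CoordLayerThin f i) :
    ∀ (k : ℕ) (f : Fin k → ℤ[X]), 0 < k → IsBatemanHornSystem f → SystemLayerConclusion k f :=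
  fun _k f hk hf =>
    systemLayerConclusion_of_coordLayerThin hk f
      (fun i => coordLayerThin_of_parts h₁ h₂ h₃ h₄ h₆ f hf i)

/-- **THE COMPOSITION.**  `BalancedSemiprimeLayer` BY NAME from the stubs S1, S2, S3, S4, S6
(sorry only inside `stub_*`; the `k = 0` slice is the PROVED `balancedSemiprimeLayer_iff_pos`). -/
theorem BalancedSemiprimeLayer_of : BalancedSemiprimeLayer :=
  balancedSemiprimeLayer_iff_pos.mpr
    (systemLayerConclusion_of_parts stub_coordLayerThin_of_typeI stub_windowMertens
      stub_typeIPairLevel stub_pairLevelForms stub_coordLayerThin_highDegree)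

/-! ## §3 The flagship sub-case: single definite quadratics `aX² + 2bX + c`, in particular `n² + 1`
(uses S1, S2, S3 and S5 only — neither the hardest stub S4 nor the residual S6) -/

/-- From the parts S1, S2, S3, S5 and the vendored DFI Proposition 1: the crux's conclusion for
every single-polynomial Bateman–Horn system `![aX² + 2bX + c]` with `ac − b² > 0`. -/
theorem systemLayerConclusion_dfiQuad_of_parts
    (h₁ : ∀ {k : ℕ} (f : Fin k → ℤ[X]), IsBatemanHornSystem f → ∀ i : Fin k,
      WindowMertens (f i) → TypeIPairLevel f i → CoordLayerThin f i)
    (h₂ : ∀ {k : ℕ} (f : Fin k → ℤ[X]), IsBatemanHornSystem f → ∀ i : Fin k,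
      (f i).natDegree ≤ 2 → WindowMertens (f i))
    (h₃ : ∀ {k : ℕ} (f : Fin k → ℤ[X]), IsBatemanHornSystem f → ∀ i : Fin k,
      (f i).natDegree ≤ 2 → ((f i).natDegree = 2 → PairLevelForms f i) → TypeIPairLevel f i)
    (h₅ : dukeFriedlanderIwaniec1995_proposition1 →
      ∀ a b c : ℤ, 0 < a * c - b ^ 2 → PairLevelForms ![DFI1995.quad a b c] 0)
    (hDFI : dukeFriedlanderIwaniec1995_proposition1) (a b c : ℤ) (hD : 0 < a * c - b ^ 2)
    (hf : IsBatemanHornSystem ![DFI1995.quad a b c]) :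
    SystemLayerConclusion 1 ![DFI1995.quad a b c] := by
  have ha : a ≠ 0 := by
    rintro rfl
    nlinarith [sq_nonneg b]
  have hdeg : ∀ i : Fin 1, (![DFI1995.quad a b c] i).natDegree = 2 := fun i => by
    rw [Matrix.cons_val_fin_one]
    show (DFI1995.quad a b c).natDegree = 2
    unfold DFI1995.quad
    exact Polynomial.natDegree_quadratic ha
  refine systemLayerConclusion_of_coordLayerThin Nat.one_pos _ (fun i => ?_)
  have hPLF : PairLevelForms ![DFI1995.quad a b c] i := by
    rw [Fin.fin_one_eq_zero i]
    exact h₅ hDFI a b c hD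
  exact h₁ _ hf i (h₂ _ hf i (hdeg i).le) (h₃ _ hf i (hdeg i).le (fun _ => hPLF))

/-- **Flagship**: modulo S1, S2, S3, S5 (no S4, no S6), DFI Proposition 1 implies the crux's
conclusion for every Bateman–Horn `![aX² + 2bX + c]` with `ac > b²`. -/
theorem systemLayerConclusion_dfiQuad (hDFI : dukeFriedlanderIwaniec1995_proposition1)
    (a b c : ℤ) (hD : 0 < a * c - b ^ 2) (hf : IsBatemanHornSystem ![DFI1995.quad a b c]) :
    SystemLayerConclusion 1 ![DFI1995.quad a b c] :=
  systemLayerConclusion_dfiQuad_of_parts stub_coordLayerThin_of_typeI stub_windowMertens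
    stub_typeIPairLevel stub_pairLevelForms_of_DFI hDFI a b c hD hf

/-- `DFI1995.quad 1 0 1 = X² + 1`. -/
theorem quad_one_zero_one : DFI1995.quad 1 0 1 = (X ^ 2 + 1 : ℤ[X]) := by
  simp [DFI1995.quad]

/-- **Flagship, `n² + 1`**: modulo S1, S2, S3, S5, DFI Proposition 1 implies the crux's conclusion
for the system `![X² + 1]` (Landau's polynomial; `IsBatemanHornSystem` by the tree's
`isBatemanHornSystem_X_sq_add_one`). -/
theorem systemLayerConclusion_X_sq_add_one (hDFI : dukeFriedlanderIwaniec1995_proposition1) :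
    SystemLayerConclusion 1 ![(X ^ 2 + 1 : ℤ[X])] := by
  have h := systemLayerConclusion_dfiQuad hDFI 1 0 1 (by norm_num)
    (by rw [quad_one_zero_one]; exact isBatemanHornSystem_X_sq_add_one)
  rw [quad_one_zero_one] at h
  exact h

end Summit.Parity.BatemanHorn.Cruxes.BalancedSemiprimeLayer.RoughRelaxedDivisorSieve
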